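import Mathlib
import HarnessLib
import Summits.ResolutionOfSingularities.ResolutionOfSingularities.Theorems.WildQuotientsWildQuotientResolutionJordanFiveWSide
import Summits.ResolutionOfSingularities.ResolutionOfSingularities.Theorems.WildQuotientsWildQuotientResolutionJordanFiveVertexCover

/-!
# RUNG V5 (`J₅`): the seam at the `μ₄`-vertex chart `chart 0 = V[x_a³] = D₊(x_a³t)` (for `HP₀`)
(crux stmt-ResolutionOfSingularities-15640 `WildQuotients.WildQuotientResolution`, line `Sketch`;
chain w45c RUNG V5 `JordanFive.jordanFive_hasResolution_of_bricks` (res-L1-w45c-lead-1 BRICK LIST v1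
`stubs/J5Bricks.lean` l.164–190: the `HP₀` binders `(ρ hρ ρB haut O₀ hO₀)` with
`hO₀ : O₀.1 = chart k n a b c d 0`), res-L1-w45c-plan-1 RULING v8.3 (d) «stub-5 owns the chart-0 seam»
(lead-1 11:58:04Z ask: HP₀'s `ψ` needs it as `H₀` did); written by res-D-pv-033 AS res-L1-w45c-stub-5.
[OURS · L1 W4.5c] — the `i = 0` member of the seam family `exists_sectionsEquiv_basicOpen_I12`
(p525870); NOT a statement of any manuscript.)

* `JordanFive.smul_X_a`, `JordanFive.smul_gens12_zero` — `⟨σ⟩` fixes `x_a` and `x_a³ = gens12 0`;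
* `JordanFive.exists_sectionsEquiv_chart0` — **THE SEAM at `chart 0`**: the `φ`-family, its powers
  clause at `x_a³t`, and `Ω₀ : (k[x][I₁₂t])_{(x_a³t)} ≃+* Γ(↥O₀.1, (O₀.1.ι ≫ π ≫ q)⁻¹ ⊤)` with (o) the
  coefficient law, (i) `Ω₀ (f/1) = (O₀.1.ι ≫ π)^* f`, (ii) `act g (Ω₀ y) = Ω₀ (φ_{g⁻¹} y)`,
  (iii) `Ω₀ y ∈ invariantsRing ⊤ ↔ ∀ g, φ_g y = y` — so `brickHP0` (res-L1-w45c-stub-4 / res-type-036)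
  reduces to algebra in `k[x][I₁₂/x_a³]`.
-/

-- single-problem summit: the doubled namespace component `ResolutionOfSingularities` is forced
set_option linter.dupNamespace false

noncomputable section

open CategoryTheory AlgebraicGeometry TopologicalSpace MvPolynomial Polynomial HomogeneousLocalization
open Literature.AlgebraicGeometry.Resolution Literature.AlgebraicGeometry.RelativeSpec
open scoped Pointwise

namespace Summit.ResolutionOfSingularities.ResolutionOfSingularities.Theorems.WildQuotientResolution.JordanFive

variable (k : Type) [Field k] (n : ℕ) (σ : MvPolynomial (Fin n) k ≃ₐ[k] MvPolynomial (Fin n) k)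
  (a b c d e : Fin n) (hab : a ≠ b) (hac : a ≠ c) (had : a ≠ d) (hae : a ≠ e)
  (hσ : ∀ i, i ≠ b → i ≠ c → i ≠ d → i ≠ e → σ (X i) = X i)

/-- `k[x] → Γ(Spec k[x], ⊤)` (local shorthand) -/
local notation3 "ι₀" => (Scheme.ΓSpecIso (CommRingCat.of (MvPolynomial (Fin n) k))).inv.hom
/-- the quotient map `q : 𝔸ⁿ → 𝔸ⁿ/⟨σ⟩` (local shorthand) -/
local notation3 "qσ" => Spec.map (CommRingCat.ofHom (algebraMap
  (FixedPoints.subalgebra k (MvPolynomial (Fin n) k) (Subgroup.zpowers σ)) (MvPolynomial (Fin n) k)))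

include hab hac had hae hσ in
/-- Every `g ∈ ⟨σ⟩` fixes `x_a`. [OURS · L1 W4.5c] [folklore] -/
theorem smul_X_a (g : ↥(Subgroup.zpowers σ)) : g • (X a : MvPolynomial (Fin n) k) = X a := by
  have hσ' : σ • (X a : MvPolynomial (Fin n) k) = X a := hσ a hab hac had hae
  obtain ⟨z, hz⟩ := Subgroup.mem_zpowers_iff.mp g.2
  change (g : MvPolynomial (Fin n) k ≃ₐ[k] MvPolynomial (Fin n) k) • (X a : MvPolynomial (Fin n) k) = _
  rw [← hz]
  exact MulAction.fixedBy_subset_fixedBy_zpow (MvPolynomial (Fin n) k) σ z hσ'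

include hab hac had hae hσ in
/-- Every `g ∈ ⟨σ⟩` fixes `gens12 0 = x_a³`. [OURS · L1 W4.5c] [folklore] -/
theorem smul_gens12_zero (g : ↥(Subgroup.zpowers σ)) :
    g • gens12 k n a b c d 0 = gens12 k n a b c d 0 := by
  have h0 : gens12 k n a b c d 0 = X a ^ 3 := by simp [gens12]
  rw [h0, smul_pow', smul_X_a k n σ a b c d e hab hac had hae hσ]

include hab hac had hae hσ in
-- the `ActionOver` binder terms are large: head-room for the statement
set_option maxHeartbeats 4000000 in
/-- **THE SEAM at `chart 0 = V[x_a³] = D₊(x_a³t)`** for the binders `(ρ hρ ρB haut O₀ hO₀)` of `HP₀`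
(`stubs/J5Bricks.lean` l.164–190): the `φ`-family, its powers clause, and
`Ω₀ : (k[x][I₁₂t])_{(x_a³t)} ≃+* Γ(↥O₀.1, (O₀.1.ι ≫ π ≫ q)⁻¹ ⊤)` with (o) the coefficient law,
(i) `Ω₀ (f/1) = (O₀.1.ι ≫ π)^* f`, (ii) `act g (Ω₀ y) = Ω₀ (φ_{g⁻¹} y)`, (iii)
`Ω₀ y ∈ invariantsRing ⊤ ↔ ∀ g, φ_g y = y`. [OURS · L1 W4.5c] [folklore; assembly of landed decls] -/
theorem exists_sectionsEquiv_chart0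
    (hI : ∀ g : ↥(Subgroup.zpowers σ), g • I12 k n a b c d = I12 k n a b c d)
    (ρ : ↥(Subgroup.zpowers σ) →* Aut (Spec (CommRingCat.of (MvPolynomial (Fin n) k))))
    (hρ : ∀ g : ↥(Subgroup.zpowers σ), (ρ g).hom = Spec.map (CommRingCat.ofHom
      ((MulSemiringAction.toRingEquiv (↥(Subgroup.zpowers σ)) (MvPolynomial (Fin n) k) g⁻¹ :
        MvPolynomial (Fin n) k ≃+* MvPolynomial (Fin n) k) :
          MvPolynomial (Fin n) k →+* MvPolynomial (Fin n) k)))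
    (hJρ : ∀ g : ↥(Subgroup.zpowers σ),
      (affineBlowup.idealSheaf (I12 k n a b c d)).comap (ρ g).hom =
        affineBlowup.idealSheaf (I12 k n a b c d))
    (ρB : ActionOver (affineBlowup.π (I12 k n a b c d) ≫ qσ) ↥(Subgroup.zpowers σ))
    (haut : ρB.aut = (affineBlowup.isBlowup (I12 k n a b c d)).liftAction ρ hJρ)
    (O₀ : ρB.StableAffineOpens) (hO₀ : O₀.1 = chart k n a b c d 0) :
    ∃ (φ : ↥(Subgroup.zpowers σ) → (reesGrading (I12 k n a b c d) →+*ᵍ reesGrading (I12 k n a b c d)))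
      (hP : ∀ g, Submonoid.powers (reesT (gens12 k n a b c d 0) (gens12_mem_I12 k n a b c d 0)) ≤
        (Submonoid.powers (reesT (gens12 k n a b c d 0) (gens12_mem_I12 k n a b c d 0))).comap (φ g))
      (Ω : HomogeneousLocalization.Away (reesGrading (I12 k n a b c d))
          (reesT (gens12 k n a b c d 0) (gens12_mem_I12 k n a b c d 0)) ≃+*
        Γ((O₀.1 : Scheme.{0}), (O₀.1.ι ≫ affineBlowup.π (I12 k n a b c d) ≫ qσ) ⁻¹ᵁ ⊤)),
      (∀ (g : ↥(Subgroup.zpowers σ)) x, ((φ g x : reesAlgebra (I12 k n a b c d)) :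
          (MvPolynomial (Fin n) k)[X]) =
        (x : (MvPolynomial (Fin n) k)[X]).map ((MulSemiringAction.toRingEquiv
          (↥(Subgroup.zpowers σ)) (MvPolynomial (Fin n) k) g⁻¹ : _ ≃+* _) : _ →+* _)) ∧
      (∀ f : MvPolynomial (Fin n) k,
        Ω (((fromZeroRingHom (reesGrading (I12 k n a b c d)) (.powers _)).comp
          (reesGrading.zeroRingHom (I12 k n a b c d))) f) =
        (O₀.1.ι ≫ affineBlowup.π (I12 k n a b c d)).appLE ⊤
          ((O₀.1.ι ≫ affineBlowup.π (I12 k n a b c d) ≫ qσ) ⁻¹ᵁ ⊤) le_top (ι₀ f)) ∧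
      (∀ (g : ↥(Subgroup.zpowers σ)) y, (ρB.restrict O₀.1 O₀.2.1).act g ⊤ (Ω y) =
        Ω (HomogeneousLocalization.map (φ g⁻¹) (hP g⁻¹) y)) ∧
      (∀ y, Ω y ∈ (ρB.restrict O₀.1 O₀.2.1).invariantsRing ⊤ ↔
        ∀ g, HomogeneousLocalization.map (φ g) (hP g) y = y) :=
  exists_sectionsEquiv_basicOpen_I12 k n σ a b c d hI _ (reesT_mem _ _) one_pos (coe_reesT _ _)
    (smul_gens12_zero k n σ a b c d e hab hac had hae hσ) ρ hρ hJρ ρB haut O₀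
    (hO₀.trans (chart_eq_basicOpen k n a b c d 0))

end Summit.ResolutionOfSingularities.ResolutionOfSingularities.Theorems.WildQuotientResolution.JordanFive

end
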